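import Mathlib
import HarnessLib
import Literature.Combinatorics.SimpleGraph.LasserreStableBound
import Summits.PneNP.PneNP.Theses.RamseyUncertifiable
import Summits.PneNP.PneNP.Theorems.RamseyUncertifiableSosUncertaintyReductions

/-!
# Route `RamseyUncertifiable`, item `SosUncertainty` (stmt-PneNP-9815) — level `2s` dominates the
# nonnegative (Schrijver-type) level `s`; `UP` implies a Schrijver uncertainty principle

Laurent's `las_t` has no nonnegativity constraints, but positive semidefiniteness of `M_t(y)` makes a
feasible `y` nonnegative on all sets of size `≤ t` (diagonal entries). Truncating a level-`2s`
feasible vector above size `2s` therefore gives a feasible vector for the NONNEGATIVE level-`s`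
program (`nonnegLasserreStableBound`, whose level `1` is Schrijver's `ϑ′` / Delsarte's LP bound in
association schemes, Laurent 2006 p. 248; used by the route `PneNP/DelsarteLasserre`):

* `isNonnegLasserreFeasible_truncate` — `y ↦ (S ↦ [|S| ≤ 2s] · y S)` maps `IsLasserreFeasible G (2s)`
  into `IsNonnegLasserreFeasible G s`, with the same singleton values;
* `lasserreStableBound_two_mul_le_nonneg` — hence `las_{2s}(G) ≤ las⁺_s(G)`; in particular
  `las₂(G) ≤ ϑ′-level bound las⁺₁(G)` (`lasserreStableBound_two_le_nonneg_one`);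
* `schrijverUncertainty_of_sosUncertainty` — so `SosUncertainty` IMPLIES the lower-tech
  **Schrijver uncertainty principle**: for every `s ≥ 1` there are `δ > 0`, `n₀` with
  `n^δ ≤ las⁺_s(G) · las⁺_s(Gᶜ)` for all graphs on `n ≥ n₀` vertices. At `s = 1` this reads
  `ϑ′(G) ϑ′(Gᶜ) ≥ n^δ` — a statement about `n × n` semidefinite programs with nonnegativity. A family
  of graphs on which Schrijver's nonnegativity cuts Lovász's `ϑ` down to `n^{o(1)}` on BOTH sides
  would refute `UP₂` (and the item); no polynomial gap between `ϑ` and `ϑ′` seems to be known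
  (refuter target recorded in the item's census).
[folklore; Laurent 2006 §3.1; Schrijver 1979]
-/

-- the Theorems namespace `Summit.PneNP.PneNP.Theorems` is prescribed by the tree layout
set_option linter.dupNamespace false

namespace Summit.PneNP.PneNP.Theorems.SosUncertainty

open Literature.Combinatorics.SimpleGraph Finset Matrix
open Summit.PneNP.PneNP.Theses.RamseyUncertifiable (SosUncertainty)

variable {V : Type} [Fintype V] [DecidableEq V]

omit [Fintype V] in
/-- **Truncation.** A level-`2s` feasible moment vector, set to `0` above size `2s`, is feasible for
the nonnegative level-`s` program: the level-`s` moment matrix only reads sets of size `≤ 2s`, where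
nothing changed, and `y_S ≥ 0` for `|S| ≤ 2s` are diagonal entries of `M_{2s}(y) ⪰ 0`. [folklore] -/
theorem isNonnegLasserreFeasible_truncate {G : SimpleGraph V} {s : ℕ} {y : Finset V → ℝ}
    (hy : IsLasserreFeasible G (2 * s) y) :
    IsNonnegLasserreFeasible G s (fun S : Finset V => if S.card ≤ 2 * s then y S else 0) := by
  refine ⟨⟨by simp [hy.empty_eq_one], fun u v huv => ?_, ?_⟩, fun S => ?_⟩
  · -- pairs
    have hc : ({u, v} : Finset V).card ≤ 2 * s ∨ ¬ ({u, v} : Finset V).card ≤ 2 * s := em _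
    rcases hc with hc | hc
    · rw [if_pos hc]; exact hy.pair_eq_zero huv
    · rw [if_neg hc]
  · -- PSD: a principal submatrix of `M_{2s}(y)`
    let f : {S : Finset V // S.card ≤ s} → {S : Finset V // S.card ≤ 2 * s} :=
      fun I => ⟨I.1, I.2.trans (by omega)⟩
    have hM : momentMatrix s (fun S : Finset V => if S.card ≤ 2 * s then y S else 0) =
        (momentMatrix (2 * s) y).submatrix f f := by
      ext I J
      have hIJ : (I.1 ∪ J.1).card ≤ 2 * s :=
        (card_union_le _ _).trans (by have := I.2; have := J.2; omega)
      simp [momentMatrix_apply, f, hIJ]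
    rw [hM]
    exact hy.posSemidef.submatrix f
  · -- nonnegativity
    by_cases hS : S.card ≤ 2 * s
    · rw [if_pos hS]; exact hy.apply_nonneg hS
    · rw [if_neg hS]

/-- **Level `2s` dominates the nonnegative level `s`**: `las_{2s}(G) ≤ las⁺_s(G)` (`s ≥ 1`).
[folklore] -/
theorem lasserreStableBound_two_mul_le_nonneg (G : SimpleGraph V) {s : ℕ} (hs : 1 ≤ s) :
    lasserreStableBound G (2 * s) ≤ nonnegLasserreStableBound G s := by
  refine lasserreStableBound_le_of_forall fun y hy => ?_
  have hfeas := isNonnegLasserreFeasible_truncate hy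
  have h := hfeas.sum_singleton_le_nonnegLasserreStableBound hs
  have hsingle : ∀ v : V, (if ({v} : Finset V).card ≤ 2 * s then y {v} else 0) = y {v} := fun v =>
    if_pos (by rw [card_singleton]; omega)
  simp only [hsingle] at h
  exact h

/-- In particular **`las₂(G) ≤ las⁺₁(G)`**, the `ϑ′`-level bound (Schrijver's `ϑ′` in association
schemes). [folklore] -/
theorem lasserreStableBound_two_le_nonneg_one (G : SimpleGraph V) :
    lasserreStableBound G 2 ≤ nonnegLasserreStableBound G 1 :=
  lasserreStableBound_two_mul_le_nonneg G le_rfl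

/-- `las⁺_s ≥ 0` for `s ≥ 1`. [folklore] -/
theorem nonnegLasserreStableBound_nonneg (G : SimpleGraph V) {s : ℕ} (hs : 1 ≤ s) :
    0 ≤ nonnegLasserreStableBound G s :=
  (Nat.cast_nonneg _).trans (indepNum_le_nonnegLasserreStableBound G s hs)

/-- **`UP` implies the Schrijver uncertainty principle** at every level: from `SosUncertainty` at
level `2s` and `las_{2s} ≤ las⁺_s` on both sides. (Registered sub-goal of stmt-PneNP-9815 for this
file.) -/
theorem schrijverUncertainty_of_sosUncertainty :
    SosUncertainty → ∀ s : ℕ, 1 ≤ s → ∃ δ : ℝ, 0 < δ ∧ ∃ n₀ : ℕ, ∀ n ≥ n₀,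
      ∀ G : SimpleGraph (Fin n),
        (n : ℝ) ^ δ ≤ nonnegLasserreStableBound G s * nonnegLasserreStableBound Gᶜ s := by
  intro h s hs
  obtain ⟨δ, hδ, n₀, hn⟩ := h (2 * s) (by omega)
  refine ⟨δ, hδ, n₀, fun n hnn G => (hn n hnn G).trans ?_⟩
  exact mul_le_mul (lasserreStableBound_two_mul_le_nonneg G hs)
    (lasserreStableBound_two_mul_le_nonneg Gᶜ hs) (lasserreStableBound_nonneg Gᶜ _ (by omega))
    (nonnegLasserreStableBound_nonneg G hs)

/-- **The converse direction is soundness of nonnegativity**: the Schrijver uncertainty principle at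
level `s` gives `UP` at level `s`, because `las⁺_s ≤ las_s` (adding constraints lowers the bound,
tree `nonnegLasserreStableBound_le_lasserreStableBound`). -/
theorem levelUP_of_schrijverUncertainty {s : ℕ} (hs : 1 ≤ s) {δ : ℝ} {n₀ : ℕ}
    (h : ∀ n ≥ n₀, ∀ G : SimpleGraph (Fin n),
      (n : ℝ) ^ δ ≤ nonnegLasserreStableBound G s * nonnegLasserreStableBound Gᶜ s) :
    ∀ n ≥ n₀, ∀ G : SimpleGraph (Fin n),
      (n : ℝ) ^ δ ≤ lasserreStableBound G s * lasserreStableBound Gᶜ s := by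
  intro n hn G
  refine (h n hn G).trans (mul_le_mul (nonnegLasserreStableBound_le_lasserreStableBound G s hs)
    (nonnegLasserreStableBound_le_lasserreStableBound Gᶜ s hs) (nonnegLasserreStableBound_nonneg Gᶜ hs)
    (lasserreStableBound_nonneg G s hs))

/-- **`SosUncertainty` is EQUIVALENT to the Schrijver uncertainty principle at all levels**: the plain
and the nonnegative hierarchies interleave, `las_{2s} ≤ las⁺_s ≤ las_s`. So the item may be attacked
entirely inside the nonnegative (`ϑ′`-type, Delsarte-type) hierarchy. -/
theorem sosUncertainty_iff_schrijverUncertainty :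
    SosUncertainty ↔ ∀ s : ℕ, 1 ≤ s → ∃ δ : ℝ, 0 < δ ∧ ∃ n₀ : ℕ, ∀ n ≥ n₀,
      ∀ G : SimpleGraph (Fin n),
        (n : ℝ) ^ δ ≤ nonnegLasserreStableBound G s * nonnegLasserreStableBound Gᶜ s := by
  refine ⟨schrijverUncertainty_of_sosUncertainty, fun h s hs => ?_⟩
  obtain ⟨δ, hδ, n₀, hn⟩ := h s hs
  exact ⟨δ, hδ, n₀, levelUP_of_schrijverUncertainty hs hn⟩

end Summit.PneNP.PneNP.Theorems.SosUncertainty
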